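import Literature.MathematicalPhysics.QuantumFieldTheory.Balaban1983to89.B9SectBGWordGradDivY
import Literature.MathematicalPhysics.QuantumFieldTheory.Balaban1983to89.B9SectBKerLettersY

/-!
# Balaban [B9], (3.25)–(3.26) pp. 394–395 — the MIDDLE WORD `D_U R(U) D*_U` of NODE 00's `Δ_a(U)` IN THE ROW-13 FRAME LETTERS: `conj_RY_eq` (NODE 00's
# projection `R(U) = I − G′Q′*(Q′G′²Q′*)⁻¹Q′G′` IS `1 − Gop∘Qcs∘Cop∘Qc∘Gop` of gen 7 ∕ gen 12's letters, print's units cancelling), ★ `conj_gradY_RY_divY_eq`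
# (DESIGN POINT 2c of the pub-ymgap N06 G-side plan)

T. Bałaban, *Propagators for lattice gauge theories in a background field*, Commun. Math. Phys. **99** (1985) 389–434
[`Balaban1985BackgroundPropagators`, "B9"].

statement-level skeleton of published theorems with citation tags; proofs where landed; nothing here is a claim about the
Yang–Mills mass gap

THE PRINTED LOCI.  (3.25) p. 394: *«Rf = (I − G′Q′*(Q′G′²Q′*)⁻¹Q′G′)f»*; (3.26) p. 395: *«Δ_a = Δ + DRD* + Q*aQ»*.

WHY THIS FILE (pub-ymgap N06 row 13, G side, seat dag-n06-c gen 13; G-SIDE-PLAN v2, Route L).  The V4 G frame (`B9SectBGFrameV4.GFrame₄`) spells `Δ_a(V)`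
as r06's word whose middle term is `conjHom b (gradLin T η⁻¹ V) ∘ (1 − Gop V ∘ Qcs V ∘ Cop V ∘ Qc V ∘ Gop V) ∘ conjHom b (divLin T η⁻¹ V)` in the ROOT letters
`Gop = conj b (η²·G′)` (gen 7 `B9SectBGpLettersY.GopC`) and the C-letters `Qc ∕ Qcs = conjHom b Q′ ∕ Q′*`, `Cop = conj b (η⁻⁴·(Q′G′²Q′*)⁻¹)` (gen 12
`B9SectBKerLettersY`).  NODE 00's middle term is `gradY U ∘ RY parS Gp U ∘ divY U` (`Node00.deltaAY`, (3.26)) with `RY = 1 − G′∘Q′*∘XinvY∘Q′∘G′` (3.25).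
THIS FILE: §1 `conj_RY_eq` — at every coded configuration `c` (letters at `decY c`), `conj b (R(decY c)|ℝ) = 1 − GopC c ∘ QcsC c ∘ CopC c ∘ QcC c ∘ GopC c`
(the units `η²·η⁻⁴·η²` cancel); §2 ★ `conj_gradY_RY_divY_eq` — in bond coordinates (`Node00/OpsYBondCoords`), `conj b ((coords ∘ (D_U R(U) D*_U) ∘ coords⁻¹)|ℝ)
= conjHom b (gradLin (shiftY) c_f (UboxY U)) ∘ (1 − GopC∘QcsC∘CopC∘QcC∘GopC)(base U) ∘ conjHom b (divLin (shiftY) c_f (UboxY U))` for every `G`-valued-or-not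
`U` (`L-2`'s `bondFunCoordsY_gradY` ∕ `divY_bondFunCoordsY_symm`), i.e. the frame's middle word up to the constant (`c_f` here, `η⁻¹ = |c_f|` in the frame).

HONEST SCOPE.  Exact finite-dimensional operator identities between DEFINED objects; no estimate; nothing of [B9] asserted; count-neutral; N06 NOT discharged;
nothing continuum ∕ OS ∕ mass-gap ∕ Clay.  No `sorry`, no `axiom`, no `def`, no `instance`.  `--supports stmt-QuantumFields-27364`.

RELATED IN THE TREE, NOT DUPLICATED: `B9SectBKerLettersY.XC_eq` (the composite `Qc∘Gop²∘Qcs`, same letters — pattern followed), `B9SectBGWordGradDivY` (L-2 — USED),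
`Node00.OpsYDeltaA` (`RY`, `XinvY`, `deltaAY`), `B9SectBGpLettersY` (`GopC`, `decY`).
-/

noncomputable section

namespace Literature.MathematicalPhysics.QuantumFieldTheory.Balaban1983to89.B9SectBGWordDRDY

open Literature.MathematicalPhysics.QuantumFieldTheory.Balaban1983to89
open Literature.MathematicalPhysics.QuantumFieldTheory.Balaban1983to89.B6KLevelCensusIndexV1 (KIdx kGeo)
open Literature.MathematicalPhysics.QuantumFieldTheory.Balaban1983to89.B9Eq352DivFormLetters (conj coordEquiv)
open Literature.MathematicalPhysics.QuantumFieldTheory.Balaban1983to89.B9Eq376POneLetters (conjHom conjHom_comp conjHom_eq_conj conjHom_sub gradLin divLin)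
open Literature.MathematicalPhysics.QuantumFieldTheory.Balaban1983to89.B9SectBCodedCarrier (CCfg)
open Literature.MathematicalPhysics.QuantumFieldTheory.Balaban1983to89.B9Eq360DeltaPrimeAY (AfldY)
open Literature.MathematicalPhysics.QuantumFieldTheory.Balaban1983to89.B9SectBGpLettersY (GopC decY conj_one)
open Literature.MathematicalPhysics.QuantumFieldTheory.Balaban1983to89.B9SectBKerLettersY (QcC QcsC CopC)
open Literature.MathematicalPhysics.QuantumFieldTheory.Balaban1983to89.B9SectBGWordGradDivY (bondFunCoordsY_gradY divY_bondFunCoordsY_symm)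
open Literature.MathematicalPhysics.QuantumFieldTheory.Balaban1983to89.B9GeoLemma21KLevelV1 (geo9K_eta_pos)
open Literature.MathematicalPhysics.QuantumFieldTheory.Balaban1983to89.Node00 (SiteY BlkY FBondY CfgY SiteParY UboxY shiftY gradY divY GpY RY XinvY QpY QpsY
  bondFunCoordsY bondFunCoordsY_apply)

variable {𝔸 : Type} [NormedRing 𝔸] [NormedAlgebra ℂ 𝔸] [CompleteSpace 𝔸]
variable {d ℓ : ℕ} {hd : 1 ≤ d + 1} {hL : Odd (ℓ + 1) ∧ 1 < ℓ + 1} {b₀ b₁ : ℝ}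
variable (i : KIdx d ℓ hd hL b₀ b₁) (par : SiteParY 𝔸 i) {ι : Type} [Fintype ι] (b : Module.Basis ι ℝ 𝔸)

/-! ## §1 The projection `R(U)` of (3.25) in the row-13 letters -/

/-- ★ **(3.25) IN THE ROW-13 LETTERS**: at every coded configuration `c`, NODE 00's projection `R(decY c) = I − G′Q′*(Q′G′²Q′*)⁻¹Q′G′` in real coordinates IS
`1 − GopC c ∘ QcsC c ∘ CopC c ∘ QcC c ∘ GopC c` — the units `η²` (of `Gop`), `η⁻⁴` (of `Cop`), `η²` cancel.
[cite: Balaban1985BackgroundPropagators, (3.25) p.394] -/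
theorem conj_RY_eq (c : CCfg (CfgY 𝔸 i) (AfldY 𝔸 i)) :
    conj b ((RY i par (GpY i par) (decY i c)).restrictScalars ℝ) =
      1 - GopC i par b c ∘ₗ QcsC i par b c ∘ₗ CopC i par b c ∘ₗ QcC i par b c ∘ₗ GopC i par b c := by
  have hR : (RY i par (GpY i par) (decY i c)).restrictScalars ℝ =
      1 - ((GpY i par (decY i c)).restrictScalars ℝ ∘ₗ (QpsY i par (decY i c)).restrictScalars ℝ ∘ₗ
        (XinvY i par (GpY i par) (decY i c)).restrictScalars ℝ ∘ₗ (QpY i par (decY i c)).restrictScalars ℝ ∘ₗ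
          (GpY i par (decY i c)).restrictScalars ℝ) := by
    refine LinearMap.ext fun f => ?_
    simp only [RY, LinearMap.restrictScalars_apply, LinearMap.sub_apply, LinearMap.id_apply, LinearMap.comp_apply, Module.End.one_apply]
  rw [hR, B9Eq352DivFormLetters.conj_sub, conj_one, GopC, QcsC, CopC, QcC, ← conjHom_eq_conj, ← conjHom_eq_conj, ← conjHom_eq_conj, conjHom_comp, conjHom_comp,
    conjHom_comp, conjHom_comp]
  congr 2
  refine LinearMap.ext fun f => ?_
  simp only [LinearMap.comp_apply, LinearMap.smul_apply, LinearMap.restrictScalars_apply, map_smul, smul_smul]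
  have hcf : |i.cf| ≠ 0 := abs_ne_zero.2 i.hcf
  have h1 : (|i.cf|⁻¹ ^ 2 * (|i.cf|⁻¹ ^ 4)⁻¹ * |i.cf|⁻¹ ^ 2 : ℝ) = 1 := by field_simp
  rw [h1, one_smul]

/-! ## §2 ★ The middle word `D_U R(U) D*_U` of `Δ_a(U)` in bond coordinates -/

/-- ★ **THE MIDDLE WORD OF (3.26) IN THE FRAME LETTERS**: in bond coordinates, NODE 00's `D_U ∘ R(U) ∘ D*_U` at the decoding of a coded configuration `c`,
realified, IS `conjHom b (gradLin (shiftY) c_f (UboxY (decY c))) ∘ (1 − GopC c∘QcsC c∘CopC c∘QcC c∘GopC c) ∘ conjHom b (divLin (shiftY) c_f (UboxY (decY c)))` —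
r06's middle word of `deltaA` at the charted background with the constant `c_f` (the frames write `η⁻¹ = |c_f|`).
[cite: Balaban1985BackgroundPropagators, (3.25)–(3.26) pp.394–395, (3.3) p.390, (3.8) p.392] -/
theorem conj_gradY_RY_divY_eq (c : CCfg (CfgY 𝔸 i) (AfldY 𝔸 i)) :
    conj b (((bondFunCoordsY i).toLinearMap ∘ₗ (gradY i (decY i c) ∘ₗ RY i par (GpY i par) (decY i c) ∘ₗ divY i (decY i c)) ∘ₗ
        (bondFunCoordsY i).symm.toLinearMap).restrictScalars ℝ) =
      conjHom b (gradLin (shiftY i) ((i.cf : ℝ) : ℂ) (UboxY i (decY i c))) ∘ₗ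
        (1 - GopC i par b c ∘ₗ QcsC i par b c ∘ₗ CopC i par b c ∘ₗ QcC i par b c ∘ₗ GopC i par b c) ∘ₗ
        conjHom b (divLin (shiftY i) ((i.cf : ℝ) : ℂ) (UboxY i (decY i c))) := by
  -- split NODE 00's composite into its three ℝ-linear factors in coordinates
  have hsplit : ((bondFunCoordsY i).toLinearMap ∘ₗ (gradY i (decY i c) ∘ₗ RY i par (GpY i par) (decY i c) ∘ₗ divY i (decY i c)) ∘ₗ
        (bondFunCoordsY i).symm.toLinearMap).restrictScalars ℝ =
      gradLin (shiftY i) ((i.cf : ℝ) : ℂ) (UboxY i (decY i c)) ∘ₗ (RY i par (GpY i par) (decY i c)).restrictScalars ℝ ∘ₗ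
        divLin (shiftY i) ((i.cf : ℝ) : ℂ) (UboxY i (decY i c)) := by
    refine LinearMap.ext fun F => ?_
    simp only [LinearMap.restrictScalars_apply, LinearMap.comp_apply, LinearEquiv.coe_coe]
    rw [← divY_bondFunCoordsY_symm, ← bondFunCoordsY_gradY]
  rw [hsplit, ← conjHom_eq_conj, ← conjHom_comp, ← conjHom_comp, conjHom_eq_conj b ((RY i par (GpY i par) (decY i c)).restrictScalars ℝ), conj_RY_eq]

end Literature.MathematicalPhysics.QuantumFieldTheory.Balaban1983to89.B9SectBGWordDRDY

end
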